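import Summits.Ventures.PercRepro.RankLevelSetHallRuleLBound

/-!
# PercRepro — RULE L PAYS EVERY MEMBER WHOSE FLAT PART HAS `q` POINTS (the slice `m = q`, `u = 0`), IN EVERY MATROID
(p4, gen 31; C-044, UP form at the tight layer; paper proofs/P4-CELL-THREE.md §14.18)

At the tight layer `#E = p + q` a member `Z′` has an independent complement, so `cl Z ∖ Z′ ⊆ E ∖ Z′` is independent and
has at most `q = r(cl Z)` points.  When the flat part of `Z` has `q` points — `#cl Z = 2q`, the largest a flat part can
be (`ncard_flatPart_le`) — every member `Z′` meets `cl Z` in at least `q` points, i.e. `Z′ ⊆ cl Z`: EVERY member inside a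
big set `S = Z ∪ X_P ∪ Y` through `Z` lies inside `Z ∪ X_P`, so `eligCount S ≤ C(q + #X_P, q)`
(`eligCount_le_of_flatPart_eq`) and the `c = 1` case of `ruleL_pays_of_bound` pays `Z` (`ruleL_pays_of_flatPart_eq`).
No hypothesis on the flat: the member condition alone disposes of every `t ≥ 1` member.  Together with
`ruleL_pays_of_flatPart_empty` (`m = 0`) the two ends of the range `0 ≤ m ≤ q` are theorems for every matroid; the
paving theorem covers every `m` on paving flats.  Axioms standard.
-/

namespace PercRepro

open Set Matroid Finset

variable {α : Type} (M : Matroid α) [M.Finite]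

omit [M.Finite] in
/-- The closure of a member is `Z ∪ flatPart Z`. -/
lemma closure_eq_union_flatPart {Z : Set α} (hZ : Z ⊆ M.E) : M.closure Z = Z ∪ flatPart M Z := by
  ext x
  constructor
  · intro hx
    by_cases hxZ : x ∈ Z
    · exact Or.inl hxZ
    · exact Or.inr ⟨⟨M.closure_subset_ground Z hx, hxZ⟩, hx⟩
  · rintro (hx | hx)
    · exact M.subset_closure Z hZ hx
    · exact hx.2

/-- At the tight layer a member `Z′` has an independent complement, so `cl Z ∖ Z′` is independent with at most `q`
points; when `#flatPart Z = q` this forces `Z′ ⊆ cl Z`. -/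
lemma subset_closure_of_flatPart_eq {p q : ℕ} (hE : M.E.ncard = p + q) {Z : Set α} (hZ : Z ∈ cellMembers M p q)
    (hm : (flatPart M Z).ncard = q) {Z' : Set α} (hZ' : Z' ∈ cellMembers M p q) : Z' ⊆ M.closure Z := by
  have hEfin : M.E.Finite := M.ground_finite
  have hZE : Z ⊆ M.E := hZ.1
  have hZ'E : Z' ⊆ M.E := hZ'.1
  have hZcard : Z.ncard = q := ncard_eq_q_of_mem_cellMembers_tight M hE hZ
  have hZ'card : Z'.ncard = q := ncard_eq_q_of_mem_cellMembers_tight M hE hZ'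
  have hZfin : Z.Finite := hEfin.subset hZE
  have hZ'fin : Z'.Finite := hEfin.subset hZ'E
  have hclE : M.closure Z ⊆ M.E := M.closure_subset_ground Z
  have hclfin : (M.closure Z).Finite := hEfin.subset hclE
  -- #cl Z = 2q
  have hclcard : (M.closure Z).ncard = q + q := by
    rw [closure_eq_union_flatPart M hZE, Set.ncard_union_eq (Set.disjoint_left.2 (fun x hxZ hxP => hxP.1.2 hxZ))
      hZfin (hEfin.subset (fun x hx => hx.1.1)), hZcard, hm]
  -- the complement of Z' is independent
  have hcompl_ind : M.Indep (M.E \ Z') := by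
    rw [indep_iff_eRk_eq_encard_of_finite (hEfin.subset Set.sdiff_subset), hZ'.2.2,
      ← (hEfin.subset Set.sdiff_subset).cast_ncard_eq, Set.ncard_sdiff' hZ'E hEfin, hE, hZ'card]
    norm_cast
    omega
  -- cl Z ∖ Z' is independent, hence has ≤ q points
  have hdiff_ind : M.Indep (M.closure Z \ Z') := hcompl_ind.subset (Set.sdiff_subset_sdiff_left hclE)
  have hdiff_le : (M.closure Z \ Z').ncard ≤ q := by
    have h1 : M.eRk (M.closure Z \ Z') ≤ M.eRk (M.closure Z) := M.eRk_mono Set.sdiff_subset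
    rw [M.eRk_closure_eq, hZ.2.1, hdiff_ind.eRk_eq_encard, ← (hclfin.subset Set.sdiff_subset).cast_ncard_eq] at h1
    exact_mod_cast h1
  -- so cl Z ∩ Z' has ≥ q = #Z' points, hence equals Z'
  have hinter : (M.closure Z ∩ Z').ncard + (M.closure Z \ Z').ncard = (M.closure Z).ncard :=
    Set.ncard_inter_add_ncard_sdiff_eq_ncard (M.closure Z) Z' hclfin
  have hge : Z'.ncard ≤ (M.closure Z ∩ Z').ncard := by omega
  have heq : M.closure Z ∩ Z' = Z' :=
    Set.eq_of_subset_of_ncard_le Set.inter_subset_right hge hZ'fin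
  intro x hx
  rw [← heq] at hx
  exact hx.1

/-- **Every member inside a big set through `Z` lies inside `Z ∪ X_P` when `#flatPart Z = q`**, so the eligible members
of `Z ∪ X_P ∪ X_D` number at most `C(#(Z ∪ X_P), q)`. -/
theorem eligCount_le_of_flatPart_eq {p q : ℕ} (hE : M.E.ncard = p + q) {Z : Set α} (hZ : Z ∈ cellMembers M p q)
    (hm : (flatPart M Z).ncard = q) {X_P X_D : Set α} (hXP : X_P ⊆ flatPart M Z)
    (hXD : X_D ⊆ M.E \ M.closure Z) :
    eligCount M p q (Z ∪ X_P ∪ X_D) ≤ (Z ∪ X_P).ncard.choose q := by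
  have hZE : Z ⊆ M.E := hZ.1
  have hGE : Z ∪ X_P ⊆ M.E := Set.union_subset hZE (fun x hx => (hXP hx).1.1)
  refine le_trans ?_ (ncard_members_subset_le_choose M hE hGE)
  unfold eligCount
  refine Set.ncard_le_ncard ?_ ((cellMembers_finite M p q).subset (fun _ h => h.1))
  intro Z' hZ'
  obtain ⟨hmem, hsub, -⟩ := hZ'
  refine ⟨hmem, ?_⟩
  intro x hx
  have hxcl : x ∈ M.closure Z := subset_closure_of_flatPart_eq M hE hZ hm hmem hx
  rcases hsub hx with hxG | hxD
  · exact hxG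
  · exact absurd hxcl (hXD hxD).2

/-- **Rule L pays every member whose flat part has `q` points** (tight layer, `q + 2 ≤ p`), in every finite matroid:
the `c = 1` case of `ruleL_pays_of_bound`. -/
theorem ruleL_pays_of_flatPart_eq (p q : ℕ) (hE : M.E.ncard = p + q) (hpq : q + 2 ≤ p) {Z : Set α}
    (hZ : Z ∈ cellMembers M p q) (hm : (flatPart M Z).ncard = q) : phiK p q ≤ ruleLRecv M p q Z := by
  refine ruleL_pays_of_bound M p q hE hpq hZ 1 le_rfl (by omega) ?_
  intro B hB _ _ Y hY _ X_P hXP _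
  have hYD : Y ⊆ M.E \ M.closure Z := hY.trans hB
  have h := eligCount_le_of_flatPart_eq M hE hZ hm hXP hYD
  have hZE : Z ⊆ M.E := hZ.1
  have hEfin : M.E.Finite := M.ground_finite
  have hcard : (Z ∪ X_P).ncard = q + X_P.ncard := by
    rw [Set.ncard_union_eq (Set.disjoint_left.2 (fun x hxZ hxX => (hXP hxX).1.2 hxZ)) (hEfin.subset hZE)
      (hEfin.subset (fun x hx => (hXP hx).1.1)), ncard_eq_q_of_mem_cellMembers_tight M hE hZ]
  rw [hcard] at h
  rw [one_mul]
  exact h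

end PercRepro
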